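import Mathlib
import Summits.NavierStokesRegularity.NavierStokesRegularity.Theorems.RootDecompLitSliceDarkBallSpreadsRegularPointRepresentative
import Literature.Analysis.Calculus.DifferenceQuotientHolder
import HarnessLib

/-!
# Route RootDecompLitSlice — brick B1 of the aside D₁ `DarkBallSpreads` (stmt-NavierStokesRegularity-29566):
# REGULAR-POINT SMOOTHING UP TO THE TERMINAL TIME, part 2 — transport and the brick

For `ν > 0`, `T > 0` and a classical solution `(u, p)` of the unforced Navier–Stokes system on `[0, T) × ℝ³`
that is Leray–Hopf on `[0, T]` from the rapidly decaying datum `u 0` (the class of D₁ / D), let `x₀` be a point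
below which `u` is bounded on some backward cylinder, i.e. `(T, x₀)` is NOT a backward singular point
(`¬ IsBackwardSingularPoint u (T, x₀)`). Then on a smaller backward cylinder `Q_r(T, x₀) = (T − r², T) × B_r(x₀)`
EVERY spatial derivative `(t, x) ↦ Dⁿₓ u(t, x)` is BOUNDED and HÖLDER CONTINUOUS in space–time (sup metric),
uniformly up to the top time `T` (`regularPoint_iteratedFDeriv_bounds`).

Proof (assembly over tree theorems, no new mathematics):
* the CKN-suitable global Leray–Hopf solution `(v, q)` from `u 0` (`exists_isGlobalLerayHopf_and_isLocalEnergySolutionOn`,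
  global `L^{3/2}` pressure) agrees with `u` a.e. on `(0,T) × ℝ³` (`isKatoSolutionOn_of_classical` +
  `IsGlobalLerayHopf.ae_eq_uncurry_of_isKatoSolutionOn_of_decay`), so it is essentially bounded on `Q_R(T, x₀)`;
* restrict to the cylinder (`IsSuitableWeakSolutionOn.mono_holds`) and normalise the viscosity by the time
  rescaling `Φ(s, y) = (T + s/ν, x₀ + y)` (`IsSuitableWeakSolutionOn.stRescale` with `α = β = ν⁻¹`, `γ = 1`): a
  unit-viscosity suitable weak solution on `Q_ρ(0, 0)`, `ρ = min(R, R√ν)`, bounded by `M/ν`, pressure in `L^{3/2}`;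
* the PROVED quantitative interior regularity of bounded distributional solutions
  `NSBoundedHigherRegularityBounds_holds` (Seregin–Šverák 2009 §2; Seregin 2014 §6.3) gives a representative with
  all spatial derivatives bounded and space–time Hölder on `Q_{ρ'}(0,0)`, `ρ' < ρ`;
* that representative coincides with the (continuous) rescaled classical solution on the open cylinder
  (`eqOn_of_ae_eq_of_continuousOn`), and the bounds are transported back to `u` along `Φ`
  (`Filter.EventuallyEq.iteratedFDeriv`, `iteratedFDeriv_comp_sub`, `iteratedFDeriv_const_smul_apply`,
  `Literature.Analysis.Calculus.holderOnWith_const_smul`).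

HONEST FRAMING: bookkeeping about a HYPOTHETICAL singular time; closes no item (D₁ still needs the flatness ⟹
infinite-order step, the ESS unique continuation application, the propagation over the connected regular slice
and the assembly with the landed B0/B5/B6′/B6″ and the writer's B2); nothing here bears on NS regularity (rung 0).
Lands `--supports stmt-NavierStokesRegularity-29566` (census instrument decomp-ns-census-1 g28).
-/

noncomputable section

open MeasureTheory Set Function Filter Topology Metric TopologicalSpace
open scoped ENNReal NNReal ContDiff
open Literature.Analysis Literature.Analysis.FluidPDE

-- the summit and its single sub-problem share the name (CONVENTIONS §1), as in every Theorems file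
set_option linter.dupNamespace false

namespace Summit.NavierStokesRegularity.NavierStokesRegularity.Theorems

/-! ### Step 3 — transport along the normalising map `ψ(t, x) = (ν (t − T), x − x₀)` -/

/-- Derivatives of `x ↦ ν • V s (x - x₀)` at a point where `V s` is smooth. [folklore] -/
theorem iteratedFDeriv_smul_comp_sub {ν : ℝ} {V : EuclideanSpace ℝ (Fin 3) → EuclideanSpace ℝ (Fin 3)}
    {x₀ x : EuclideanSpace ℝ (Fin 3)} {n : ℕ} (hV : ContDiffAt ℝ n V (x - x₀)) :
    iteratedFDeriv ℝ n (fun x' => ν • V (x' - x₀)) x = ν • iteratedFDeriv ℝ n V (x - x₀) := by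
  have h1 : ContDiffAt ℝ n (fun x' => V (x' - x₀)) x :=
    hV.comp x (contDiffAt_id.sub contDiffAt_const)
  rw [iteratedFDeriv_const_smul_apply' h1, iteratedFDeriv_comp_sub]

/-- The normalising map `ψ(t, x) = (ν (t − T), x − x₀)` sends `Q_r(T, x₀)` into `Q_{r₁}(0, 0)` when `r ≤ r₁` and
`ν r² ≤ r₁²`. [folklore] -/
theorem mapsTo_normalise_parabolicCylinder {ν T r r₁ : ℝ} (hν : 0 < ν) (hrr₁ : r ≤ r₁) (hrν : ν * r ^ 2 ≤ r₁ ^ 2)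
    (x₀ : EuclideanSpace ℝ (Fin 3)) :
    ∀ w ∈ parabolicCylinder r ((T : ℝ), x₀),
      ((ν * (w.1 - T), w.2 - x₀) : ℝ × EuclideanSpace ℝ (Fin 3)) ∈
        parabolicCylinder r₁ ((0 : ℝ), (0 : EuclideanSpace ℝ (Fin 3))) := by
  rintro ⟨t, x⟩ hw
  rw [mem_parabolicCylinder] at hw ⊢
  simp only at hw ⊢
  refine ⟨⟨?_, ?_⟩, ?_⟩
  · nlinarith [hw.1.1]
  · nlinarith [hw.1.2]
  · rw [dist_zero_right, ← dist_eq_norm]; exact lt_of_lt_of_le hw.2 hrr₁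

/-- The normalising map is Lipschitz in the sup metric of `ℝ × ℝ³`, with constant `max |ν| 1`. [folklore] -/
theorem lipschitzWith_normalise (ν T : ℝ) (x₀ : EuclideanSpace ℝ (Fin 3)) :
    LipschitzWith (max ‖ν‖₊ 1)
      (fun w : ℝ × EuclideanSpace ℝ (Fin 3) => ((ν * (w.1 - T), w.2 - x₀) : ℝ × EuclideanSpace ℝ (Fin 3))) := by
  refine LipschitzWith.of_dist_le_mul fun w w' => ?_
  rw [Prod.dist_eq, Prod.dist_eq, NNReal.coe_max, coe_nnnorm, Real.norm_eq_abs, NNReal.coe_one]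
  have h1 : dist (ν * (w.1 - T)) (ν * (w'.1 - T)) = |ν| * dist w.1 w'.1 := by
    rw [Real.dist_eq, Real.dist_eq, ← abs_mul]; ring_nf
  have h2 : dist (w.2 - x₀) (w'.2 - x₀) = dist w.2 w'.2 := by
    rw [dist_eq_norm, dist_eq_norm]; congr 1; abel
  simp only
  rw [h1, h2]
  have hm : 0 ≤ max (dist w.1 w'.1) (dist w.2 w'.2) := by positivity
  refine max_le ?_ ?_
  · calc |ν| * dist w.1 w'.1 ≤ max |ν| 1 * dist w.1 w'.1 :=
          mul_le_mul_of_nonneg_right (le_max_left _ _) dist_nonneg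
      _ ≤ max |ν| 1 * max (dist w.1 w'.1) (dist w.2 w'.2) :=
          mul_le_mul_of_nonneg_left (le_max_left _ _) (by positivity)
  · calc dist w.2 w'.2 = 1 * dist w.2 w'.2 := (one_mul _).symm
      _ ≤ max |ν| 1 * max (dist w.1 w'.1) (dist w.2 w'.2) :=
          mul_le_mul (le_max_right _ _) (le_max_right _ _) dist_nonneg (by positivity)

/-- **Transport of derivatives.** If `V` agrees with `ν⁻¹ (u ∘ Φ)`, `Φ(s, y) = (T + s/ν, x₀ + y)`, on `Q_{r₁}(0,0)` and
has smooth slices there, then on `Q_r(T, x₀)` (`r ≤ r₁`, `ν r² ≤ r₁²`):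
`Dⁿₓu(t, x) = ν • DⁿₓV(ν (t − T), x − x₀)`. [folklore] -/
theorem iteratedFDeriv_eq_smul_of_eqOn_cylinder {ν T r r₁ : ℝ} (hν : 0 < ν) (hrr₁ : r ≤ r₁)
    (hrν : ν * r ^ 2 ≤ r₁ ^ 2) {u V : ℝ → EuclideanSpace ℝ (Fin 3) → EuclideanSpace ℝ (Fin 3)}
    {x₀ : EuclideanSpace ℝ (Fin 3)}
    (hEq : EqOn (uncurry V) (uncurry (ν⁻¹ • stPull ν⁻¹ 1 T x₀ u))
      (parabolicCylinder r₁ ((0 : ℝ), (0 : EuclideanSpace ℝ (Fin 3)))))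
    (hVsmooth : ∀ w ∈ parabolicCylinder r₁ ((0 : ℝ), (0 : EuclideanSpace ℝ (Fin 3))),
      ContDiffAt ℝ (⊤ : ℕ∞) (V w.1) w.2)
    (n : ℕ) : ∀ w ∈ parabolicCylinder r ((T : ℝ), x₀),
      iteratedFDeriv ℝ n (u w.1) w.2 = ν • iteratedFDeriv ℝ n (V (ν * (w.1 - T))) (w.2 - x₀) := by
  have hψ := mapsTo_normalise_parabolicCylinder (T := T) hν hrr₁ hrν x₀
  -- values: `u t x = ν • V (ν (t - T)) (x - x₀)` on `Q_r(T, x₀)`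
  have hval : ∀ w ∈ parabolicCylinder r ((T : ℝ), x₀), u w.1 w.2 = ν • V (ν * (w.1 - T)) (w.2 - x₀) := by
    intro w hw
    have e := hEq (hψ w hw)
    simp only [uncurry_apply_pair, Pi.smul_apply, stPull_apply, one_smul] at e
    have e2 : T + ν⁻¹ * (ν * (w.1 - T)) = w.1 := by field_simp; ring
    rw [e2, add_sub_cancel] at e
    rw [e, smul_smul, mul_inv_cancel₀ hν.ne', one_smul]
  rintro ⟨t, x⟩ hw
  have hwc := hw
  rw [mem_parabolicCylinder] at hwc
  have hev : (u t) =ᶠ[𝓝 x] fun x' => ν • V (ν * (t - T)) (x' - x₀) := by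
    have hball : ball x₀ r ∈ 𝓝 x := isOpen_ball.mem_nhds (by simpa using hwc.2)
    filter_upwards [hball] with x' hx'
    exact hval (t, x') (by rw [mem_parabolicCylinder]; exact ⟨hwc.1, mem_ball.1 hx'⟩)
  rw [(hev.iteratedFDeriv ℝ n).self_of_nhds]
  have hsm : ContDiffAt ℝ n (V (ν * (t - T))) (x - x₀) :=
    (hVsmooth _ (hψ (t, x) hw)).of_le (by exact_mod_cast le_top)
  exact iteratedFDeriv_smul_comp_sub hsm


/-! ### Step 4 — the brick -/

/-- **Brick B1 — regular-point smoothing up to the terminal time.** For `ν > 0`, `T > 0`, a classical unforced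
Navier–Stokes solution `(u, p)` on `[0, T) × ℝ³` that is Leray–Hopf on `[0, T]` from the rapidly decaying datum
`u 0`, and a point `x₀` with `(T, x₀)` NOT backward singular, there is a backward cylinder `Q_r(T, x₀)`,
`r² < T`, on which every spatial derivative `(t, x) ↦ Dⁿₓu(t, x)` is bounded and Hölder continuous in space–time
(sup metric), uniformly up to `t = T` (Seregin–Šverák 2009 §2 / Seregin 2014 §6.3 via the tree's
`NSBoundedHigherRegularityBounds_holds`, applied to the viscosity-normalised suitable Leray–Hopf continuation and
transported back). [cite: SereginSverak2009, §2 p. 8] [cite: Seregin2014, §6.3, proof of Prop. 3.10] -/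
theorem regularPoint_iteratedFDeriv_bounds {ν T : ℝ} (hν : 0 < ν) (hT : 0 < T)
    {u : ℝ → EuclideanSpace ℝ (Fin 3) → EuclideanSpace ℝ (Fin 3)} {p : ℝ → EuclideanSpace ℝ (Fin 3) → ℝ}
    (hsol : IsClassicalNSSolutionOn (Ico 0 T) ν 0 u p) (hLH : IsLerayHopfOn T ν 0 (u 0) u)
    (hdec : HasRapidSpatialDecay (u 0)) {x₀ : EuclideanSpace ℝ (Fin 3)}
    (hx₀ : ¬ IsBackwardSingularPoint u ((T : ℝ), x₀)) :
    ∃ r : ℝ, 0 < r ∧ r ^ 2 < T ∧ ∀ n : ℕ, ∃ K C α : ℝ≥0, 0 < α ∧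
      HolderOnWith C α (fun w : ℝ × EuclideanSpace ℝ (Fin 3) => iteratedFDeriv ℝ n (u w.1) w.2)
        (parabolicCylinder r ((T : ℝ), x₀)) ∧
      ∀ w ∈ parabolicCylinder r ((T : ℝ), x₀), ‖iteratedFDeriv ℝ n (u w.1) w.2‖ ≤ K := by
  obtain ⟨ρ, V, K, C, α, hρ, hρT, hα, hVsmooth, hV, hEq⟩ := exists_holder_representative hν hT hsol hLH hdec hx₀
  set r₁ : ℝ := ρ / 2 with hr₁_def
  have hr₁ : r₁ ∈ Ioo 0 ρ := ⟨by positivity, by rw [hr₁_def]; linarith⟩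
  have hsub₁ : parabolicCylinder r₁ ((0 : ℝ), (0 : EuclideanSpace ℝ (Fin 3))) ⊆
      parabolicCylinder ρ ((0 : ℝ), (0 : EuclideanSpace ℝ (Fin 3))) :=
    parabolicCylinder_subset_of_le hr₁.1.le hr₁.2.le _
  -- the cylinder `Q_r(T, x₀)`
  set r : ℝ := min r₁ (r₁ / Real.sqrt ν) with hr_def
  have hsν : 0 < Real.sqrt ν := Real.sqrt_pos.2 hν
  have hr : 0 < r := lt_min hr₁.1 (div_pos hr₁.1 hsν)
  have hrr₁ : r ≤ r₁ := min_le_left _ _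
  have hrν : ν * r ^ 2 ≤ r₁ ^ 2 := by
    have h1 : r ≤ r₁ / Real.sqrt ν := min_le_right _ _
    have h2 : r ^ 2 ≤ (r₁ / Real.sqrt ν) ^ 2 := pow_le_pow_left₀ hr.le h1 2
    rw [div_pow, Real.sq_sqrt hν.le, le_div_iff₀ hν, mul_comm] at h2
    exact h2
  have hrT : r ^ 2 < T := by
    have h1 : r ^ 2 ≤ r₁ ^ 2 := pow_le_pow_left₀ hr.le hrr₁ 2
    have h2 : r₁ ^ 2 ≤ ρ ^ 2 := pow_le_pow_left₀ hr₁.1.le hr₁.2.le 2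
    have h3 : ρ ^ 2 ≤ T * ν := (div_lt_iff₀ hν).1 hρT |>.le
    have h4 : ν * r ^ 2 < T * ν := by nlinarith
    nlinarith
  have hψ := mapsTo_normalise_parabolicCylinder (T := T) hν hrr₁ hrν x₀
  have hder := iteratedFDeriv_eq_smul_of_eqOn_cylinder hν hrr₁ hrν hEq (fun w hw => hVsmooth w (hsub₁ hw))
  have hψL := lipschitzWith_normalise ν T x₀
  refine ⟨r, hr, hrT, fun n => ?_⟩
  obtain ⟨hHol, hBd⟩ := hV n r₁ hr₁
  have hcomp : HolderOnWith (C n r₁ * (max ‖ν‖₊ 1) ^ ((α n r₁ : ℝ))) (α n r₁ * 1)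
      ((fun w : ℝ × EuclideanSpace ℝ (Fin 3) => iteratedFDeriv ℝ n (V w.1) w.2) ∘
        fun w : ℝ × EuclideanSpace ℝ (Fin 3) => ((ν * (w.1 - T), w.2 - x₀) : ℝ × EuclideanSpace ℝ (Fin 3)))
      (parabolicCylinder r ((T : ℝ), x₀)) :=
    hHol.comp (hψL.holderWith.holderOnWith _) fun w hw => hψ w hw
  have hcomp2 := Literature.Analysis.Calculus.holderOnWith_const_smul hcomp ν
  refine ⟨‖ν‖₊ * K n r₁, ‖ν‖₊ * (C n r₁ * (max ‖ν‖₊ 1) ^ ((α n r₁ : ℝ))), α n r₁ * 1, ?_, ?_, ?_⟩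
  · rw [mul_one]; exact hα n r₁ hr₁
  · intro w hw w' hw'
    have key := hcomp2 w hw w' hw'
    simp only [Function.comp_apply] at key
    rw [← hder n w hw, ← hder n w' hw'] at key
    exact key
  · intro w hw
    have hb := hBd _ (hψ w hw)
    simp only at hb
    rw [hder n w hw, norm_smul, NNReal.coe_mul, coe_nnnorm]
    exact mul_le_mul_of_nonneg_left hb (norm_nonneg _)

end Summit.NavierStokesRegularity.NavierStokesRegularity.Theorems
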